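import Summits.QuantumFields.YangMills.Theorems.FibreConvexityTailOfFirstExitWindowTailL
import Summits.QuantumFields.YangMills.Theorems.SmallFieldWideningPlainStabAdd

/-!
# Route `FibreConvexityTail`, crux `TwoSidedTailL` (stmt-QuantumFields-25567) ⇐ crux r4 `PlainStabAdd` (stmt-QuantumFields-27718,
# route `SmallFieldWidening`, LINE g6-B «additive unit-stability ladder») — cross-route certificate (seat ym-line-fct-p1 g11)

WHAT.  The second machine-visible feeder of the crux `TwoSidedTailL`.  The tree already holds
* `FibreConvexityTail.twoSidedTailL_of_firstExitWindowTailL : FirstExitWindowTailL → TwoSidedTailL` (p623468: the two-sided event is a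
  sub-event of the first-exit event of crux stmt-QuantumFields-26243 at the one-step window's widening), and
* `LargeFieldMassRefinementTailPlainStabAdd.firstExitWindowTailL_of_plainStabAdd : PlainStabAdd → FirstExitWindowTailL` (planner ym-idea-1 g6
  glue of LINE g6-B through the normal form `UnitTop`),
so `PlainStabAdd → TwoSidedTailL` is their composition.  It is recorded here as a declaration so that the ledger shows, on stmt-QuantumFields-25567
itself, that closing EITHER of stmt-QuantumFields-26243 / stmt-QuantumFields-27718 closes this crux mechanically (closing recipe:
`Cruxes/TwoSidedTailL/Lines/shared_first_exit.md`; the only ideated line of this route, «birth» = fibre log-concavity + Herbst, is dead for the deep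
heights by instrument JOB B, `Cruxes/TwoSidedTailL/Lines/birth_dead.md`).

HONEST SCOPE.  A conditional certificate only: `PlainStabAdd`, `FirstExitWindowTailL`, `TwoSidedTailL`, the route and rung R3 (`YM3TorusSU2`, a RECORD
rung of the programme, not the Clay statement) all stay OPEN; nothing here bears on the Yang–Mills mass gap.  The converse is not claimed
(`PlainStabAdd` / `FirstExitWindowTailL` have constants uniform in the family and the coupling; `TwoSidedTailL` quantifies them after `(F, γ)`).
References: T. Bałaban, Commun. Math. Phys. **102** (1985) 255–275 [Balaban1985UV3] ((70)–(71) p.273); CMP **98** (1985) 17–51 [Balaban1985Averaging] (Prop. 1 (51) p.26).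
-/

noncomputable section

namespace Summit.QuantumFields.YangMills.Theorems.FibreConvexityTail

/-- **`TwoSidedTailL` (stmt-QuantumFields-25567) ⇐ `PlainStabAdd` (stmt-QuantumFields-27718).**  Composition of the landed certificates
`firstExitWindowTailL_of_plainStabAdd` (crux r4 of route `SmallFieldWidening` ⇒ crux `FirstExitWindowTailL` of route `FirstExitWindow`) and
`twoSidedTailL_of_firstExitWindowTailL` (⇒ this route's two-sided-conditioned tail, by monotonicity of the Gibbs probability).  Conditional
certificate; `PlainStabAdd` is NOT proved; nothing about the mass gap. [cite: Balaban1985UV3, (70)-(71) p.273] -/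
theorem twoSidedTailL_of_plainStabAdd
    (h : Summit.QuantumFields.YangMills.Theses.SmallFieldWidening.PlainStabAdd) :
    Summit.QuantumFields.YangMills.Theses.FibreConvexityTail.TwoSidedTailL :=
  twoSidedTailL_of_firstExitWindowTailL
    (LargeFieldMassRefinementTailPlainStabAdd.firstExitWindowTailL_of_plainStabAdd h)

end Summit.QuantumFields.YangMills.Theorems.FibreConvexityTail

end
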